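import Literature.Barriers.SmoothPoincare4.SmallExoticaFrontierReductionLemma8BlockOneModelProofs
import HarnessLib

/-!
# Akhmedov–Park 2010, Lemma 8, block 1: `Y₁(1,1)` — the four torus surgeries on `Σ₂ × T²` EXIST

Proof file (theorems only, no definition, no named fact) for the Seiberg–Witten leaf
`Literature.Barriers.SmoothPoincare4.akhmedovPark2010_lemma8_invariants` (A. Akhmedov,
B. D. Park, Invent. Math. 181 (2010) 577–603, §9): "For each pair of integers `p ≥ 0` and `q ≥ 0`,
let `Y₁(1/p, 1/q)` be the result of the following 4 torus surgeries on `Σ₂ × T²`: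
`(a₁′ × c′, a₁′, -1), (b₁′ × c″, b₁′, -1), (a₂′ × c′, c′, +1/p), (a₂″ × d′, d′, +1/q)`" (eq. (9.1)),
and "`Σ₂ = Σ₂ × (½, ½) ⊂ Y₁(1/p, 1/q)` … is disjoint from the neighborhoods of four Luttinger
surgery tori".  From the smooth model with its five tubes
(`akhmedovPark2010_lemma8_blockOne_model`, `…BlockOneModelProofs.lean`) this file performs the
four surgeries (`p = q = 1`, all four of rotation type,
`akhmedovPark2010_lemma8_rotation_block_step`), carrying the remaining tubes smoothly through
each step (`akhmedovPark2010_lemma8_smooth_tube_transport`):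

* §19 `akhmedovPark2010_lemma8_rotation_step_transport` — **one rotation surgery step with
  transport of a fibre tube and a family of torus tubes** disjoint from the surgery tube:
  the reglued manifold keeps the block data (connected, `ℤ`-orientable, `|σ| = n`, `e`), and the
  transported tubes stay smooth embeddings with open ranges, pairwise disjoint;
* §20 `akhmedovPark2010_lemma8_blockOne` — **block 1 EXISTS**: a closed connected `ℤ`-orientable
  smooth `4`-manifold `Y` (our `Y₁(1,1)`) with `|σ| = 0` for all orientations and `e(Y) = 0`,
  carrying a smooth tube `Σ₂ × ℝ² → Y` with open range of the genus-two surface `Σ₂`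
  (`e(Σ₂) = -2`, finitely generated homology) — exactly the first-block hypotheses of
  `akhmedovPark2010_lemma8_exists_fibreSum_of_smooth_blocks` /
  `akhmedovPark2010_lemma8_invariants_of_blocks_vanKampen` (§16, §13), with
  `(e(Y) - e(Σ₂)) = 0 + 2` as printed ("`e(X₁(m)) = … = 0 + 1 + 4 = 5`").

What is NOT supplied: block 2 (`Z''(1, m)`: the surface `Σ̄₂ ⊂ T⁴ # ℂℙ²bar` of §3 and the two
surgeries of eq. (4.1)), the `π₁` presentations, Seiberg–Witten.

## References

* [AkhmedovPark2010] A. Akhmedov, B. D. Park, Invent. Math. 181 (2010) 577–603 =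
  arXiv:math/0701829: §2, §9 eq. (9.1) and the proof of Lemma 8.
-/

noncomputable section

open scoped Manifold ContDiff Topology
open Set Function Module
open Literature.AlgebraicTopology.SingularHomology
open Literature.Topology.FourManifolds

namespace Literature.Barriers.SmoothPoincare4

/-! ### §19 One rotation surgery step with transport of the other tubes -/

/-- **One rotation torus surgery step, with transport of a fibre tube and of a family of further
torus tubes.**  Let `Y` be a closed connected `ℤ`-orientable smooth `4`-manifold with `|σ| = n`
for all orientations, `T' : F' × ℝ² → Y` a smooth surgery tube (`F'` a closed connected surface
with finitely generated homology) with rotation character `χ : F' → S¹`, `T₀ : F × ℝ² → Y` a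
smooth tube and `S i : F' × ℝ² → Y` (`i ∈ ι`) smooth tubes, all with open ranges, `T₀` and the
`S i` disjoint from `T'`, `T₀` disjoint from the `S i`, the `S i` pairwise disjoint.  Then the
reglued manifold `P` of `akhmedovPark2010_lemma8_rotation_block_step` (connected, `ℤ`-orientable,
`|σ| = n`, `e(P) = e(Y)`) carries the transported tubes `ι ∘ T₀`, `ι ∘ S i`
(`akhmedovPark2010_lemma8_smooth_tube_transport`; they miss the core of `T'`), smooth embeddings
with open ranges, with the same disjointness (`ι` is injective).  (Akhmedov–Park 2010 §9:
"`Σ₂` … is disjoint from the neighborhoods of four Luttinger surgery tori", and the tori are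
pairwise disjoint.) [cite: AkhmedovPark2010, §2 and §9 eq. (9.1)] -/
theorem akhmedovPark2010_lemma8_rotation_step_transport {ι : Type}
    {Y : Type} [TopologicalSpace Y] [T2Space Y] [SecondCountableTopology Y] [CompactSpace Y]
    [ConnectedSpace Y] [ChartedSpace (EuclideanSpace ℝ (Fin 4)) Y] [IsManifold (𝓡 4) ∞ Y]
    -- the surgery tube with its character
    {F' : Type} [TopologicalSpace F'] [T2Space F'] [CompactSpace F'] [ConnectedSpace F']
    [ChartedSpace (EuclideanSpace ℝ (Fin 2)) F'] [IsManifold (𝓡 2) ∞ F']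
    (hF' : FinRelHomology ℤ ℤ F' ∅ 4)
    {T' : F' × EuclideanSpace ℝ (Fin 2) → Y}
    (hT' : Manifold.IsSmoothEmbedding ((𝓡 2).prod (𝓡 2)) (𝓡 4) ∞ T') (hT'o : IsOpen (range T'))
    {χ : F' → Circle} (hχ : ContMDiff (𝓡 2) (𝓡 1) ∞ χ)
    -- the numbers of `Y`
    (hY : IsOrientableOver ℤ Y 4) {n : ℕ}
    (hσ : ∀ ν : HomologicalOrientation ℤ Y 4, ν.signature.natAbs = n)
    -- the fibre tube and the other torus tubes
    {F : Type} [TopologicalSpace F] [ChartedSpace (EuclideanSpace ℝ (Fin 2)) F]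
    [IsManifold (𝓡 2) ∞ F]
    {T₀ : F × EuclideanSpace ℝ (Fin 2) → Y}
    (hT₀ : Manifold.IsSmoothEmbedding ((𝓡 2).prod (𝓡 2)) (𝓡 4) ∞ T₀) (hT₀o : IsOpen (range T₀))
    (hd₀ : Disjoint (range T₀) (range T'))
    {S : ι → F' × EuclideanSpace ℝ (Fin 2) → Y}
    (hS : ∀ i, Manifold.IsSmoothEmbedding ((𝓡 2).prod (𝓡 2)) (𝓡 4) ∞ (S i) ∧ IsOpen (range (S i)))
    (hdS : ∀ i, Disjoint (range (S i)) (range T'))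
    (hd₀S : ∀ i, Disjoint (range T₀) (range (S i)))
    (hdSS : ∀ i j, i ≠ j → Disjoint (range (S i)) (range (S j))) :
    ∃ (P : Type) (_ : TopologicalSpace P) (_ : T2Space P) (_ : SecondCountableTopology P)
      (_ : CompactSpace P) (_ : ConnectedSpace P) (_ : ChartedSpace (EuclideanSpace ℝ (Fin 4)) P)
      (_ : IsManifold (𝓡 4) ∞ P)
      (T₀' : F × EuclideanSpace ℝ (Fin 2) → P) (S' : ι → F' × EuclideanSpace ℝ (Fin 2) → P),
      IsOrientableOver ℤ P 4 ∧ (∀ ν : HomologicalOrientation ℤ P 4, ν.signature.natAbs = n) ∧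
      relEuler ℤ ℤ P ∅ = relEuler ℤ ℤ Y ∅ ∧
      (Manifold.IsSmoothEmbedding ((𝓡 2).prod (𝓡 2)) (𝓡 4) ∞ T₀' ∧ IsOpen (range T₀')) ∧
      (∀ i, Manifold.IsSmoothEmbedding ((𝓡 2).prod (𝓡 2)) (𝓡 4) ∞ (S' i) ∧
        IsOpen (range (S' i))) ∧
      (∀ i, Disjoint (range T₀') (range (S' i))) ∧
      (∀ i j, i ≠ j → Disjoint (range (S' i)) (range (S' j))) := by
  obtain ⟨P, _, _, _, _, _, _, A, ιA, hconn, hP, hσP, heP, hAeq, hι, hιo⟩ :=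
    akhmedovPark2010_lemma8_rotation_block_step hF' hT' hT'o hχ hY hσ
  haveI := hconn
  have hιi : Injective ιA := hι.isEmbedding.injective
  -- tubes disjoint from `T'` miss its core, hence lie in `A`
  have hcore : (range fun f : F' => T' (f, 0)) ⊆ range T' := by
    rintro _ ⟨f, rfl⟩; exact ⟨_, rfl⟩
  have hmem : ∀ {Z : Type} (R : Z → Y), Disjoint (range R) (range T') → ∀ z, R z ∈ A := by
    intro Z R hR z
    rw [← SetLike.mem_coe, hAeq, mem_compl_iff]
    exact fun h => Set.disjoint_left.1 hR ⟨z, rfl⟩ (hcore h)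
  have hm₀ : ∀ x, T₀ x ∈ A := hmem T₀ hd₀
  have hmS : ∀ i x, S i x ∈ A := fun i => hmem (S i) (hdS i)
  obtain ⟨h₀e, h₀o⟩ := akhmedovPark2010_lemma8_smooth_tube_transport A hι hιo hT₀ hT₀o hm₀
  have hS' : ∀ i, Manifold.IsSmoothEmbedding ((𝓡 2).prod (𝓡 2)) (𝓡 4) ∞
      (fun x => ιA ⟨S i x, hmS i x⟩) ∧ IsOpen (range fun x => ιA ⟨S i x, hmS i x⟩) := fun i =>
    akhmedovPark2010_lemma8_smooth_tube_transport A hι hιo (hS i).1 (hS i).2 (hmS i)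
  refine ⟨P, inferInstance, inferInstance, inferInstance, inferInstance, hconn, inferInstance,
    inferInstance, fun x => ιA ⟨T₀ x, hm₀ x⟩, fun i x => ιA ⟨S i x, hmS i x⟩, hP, hσP, heP,
    ⟨h₀e, h₀o⟩, hS', ?_, ?_⟩
  · intro i
    refine Set.disjoint_left.2 ?_
    rintro _ ⟨x, rfl⟩ ⟨y, hy⟩
    have h := congrArg Subtype.val (hιi hy)
    exact Set.disjoint_left.1 (hd₀S i) ⟨x, rfl⟩ ⟨y, h⟩
  · intro i j hij
    refine Set.disjoint_left.2 ?_
    rintro _ ⟨x, rfl⟩ ⟨y, hy⟩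
    have h := congrArg Subtype.val (hιi hy)
    exact Set.disjoint_left.1 (hdSS i j hij) ⟨x, rfl⟩ ⟨y, h⟩

/-! ### §20 Block 1: `Y₁(1,1)` with its smooth `Σ₂`-tube EXISTS -/

/-- **Block 1 of Akhmedov–Park's `X₁(m)` EXISTS: `Y₁(1,1)`, the four torus surgeries of eq. (9.1)
on `Σ₂ × T²`, with its smooth `Σ₂`-tube.**  There are a closed connected smooth surface `F` with
finitely generated homology and `e(F) = -2` (the genus-two surface) and a closed connected
`ℤ`-orientable smooth `4`-manifold `Y` — `Σ₂ × T²` with the tori `a₁ × c′`, `b₁ × c″`, `a₂′ × c′`,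
`a₂″ × d′` reglued by the rotations `χ₁⁻¹`, `χ₁⁻¹`, `χ₂`, `χ₂` (the surgeries
`(a₁′ × c′, a₁′, -1)`, `(b₁′ × c″, b₁′, -1)`, `(a₂′ × c′, c′, +1)`, `(a₂″ × d′, d′, +1)`) — with
`|σ| = 0` for all its `ℤ`-orientations and `e(Y) = 0`, carrying a smooth tube `F × ℝ² → Y` with
open range (the surface "`Σ₂ = Σ₂ × (½, ½)`" along which the fibre sum of Lemma 8 is taken).
These are the first-block hypotheses of `akhmedovPark2010_lemma8_exists_fibreSum_of_smooth_blocks`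
and §13, with `e(Y) - e(F) = 0 + 2`. [cite: AkhmedovPark2010, §2, §9 eq. (9.1) and proof of Lemma 8] -/
theorem akhmedovPark2010_lemma8_blockOne :
    ∃ (F : Type) (_ : TopologicalSpace F) (_ : T2Space F) (_ : SecondCountableTopology F)
      (_ : CompactSpace F) (_ : ConnectedSpace F) (_ : ChartedSpace (EuclideanSpace ℝ (Fin 2)) F)
      (_ : IsManifold (𝓡 2) ∞ F)
      (Y : Type) (_ : TopologicalSpace Y) (_ : T2Space Y) (_ : SecondCountableTopology Y)
      (_ : CompactSpace Y) (_ : ConnectedSpace Y) (_ : ChartedSpace (EuclideanSpace ℝ (Fin 4)) Y)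
      (_ : IsManifold (𝓡 4) ∞ Y) (TY : F × EuclideanSpace ℝ (Fin 2) → Y),
      (FinRelHomology ℤ ℤ F ∅ 4 ∧ relEuler ℤ ℤ F ∅ = -2) ∧ IsOrientableOver ℤ Y 4 ∧
      (∀ ν : HomologicalOrientation ℤ Y 4, ν.signature.natAbs = 0) ∧ relEuler ℤ ℤ Y ∅ = 0 ∧
      Manifold.IsSmoothEmbedding ((𝓡 2).prod (𝓡 2)) (𝓡 4) ∞ TY ∧ IsOpen (range TY) := by
  obtain ⟨F, _, _, _, _, _, _, _, F', _, _, _, _, _, _, χ₁, χ₂, X, _, _, _, _, _, _, _, T, T₁, T₂,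
    T₃, T₄, hHF, hHF', hχ₁, hχ₂, hOX, hσX, heX, hT, hT₁, hT₂, hT₃, hT₄, hD01, hD02, hD03, hD04,
    hD12, hD13, hD14, hD23, hD24, hD34⟩ := akhmedovPark2010_lemma8_blockOne_model
  have hχ₁' : ContMDiff (𝓡 2) (𝓡 1) ∞ fun w => (χ₁ w)⁻¹ := hχ₁.inv
  -- step 1: surgery on `T₁` (`(a₁′ × c′, a₁′, -1)`), transporting `T`, `T₂`, `T₃`, `T₄`
  obtain ⟨P₁, _, _, _, _, _, _, _, U₁, S₁, hO₁, hσ₁, he₁, hU₁, hS₁, hUS₁, hSS₁⟩ :=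
    akhmedovPark2010_lemma8_rotation_step_transport (ι := Fin 3) hHF' hT₁.1 hT₁.2 hχ₁' hOX hσX
      hT.1 hT.2 hD01 (S := ![T₂, T₃, T₄])
      (fun i => by fin_cases i <;> assumption)
      (fun i => by
        fin_cases i
        · exact hD12.symm
        · exact hD13.symm
        · exact hD14.symm)
      (fun i => by
        fin_cases i
        · exact hD02
        · exact hD03
        · exact hD04)
      (fun i j hij => by
        fin_cases i <;> fin_cases j
        · exact absurd rfl hij
        · exact hD23
        · exact hD24
        · exact hD23.symm
        · exact absurd rfl hij
        · exact hD34
        · exact hD24.symm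
        · exact hD34.symm
        · exact absurd rfl hij)
  -- step 2: surgery on the transported `T₂` (`(b₁′ × c″, b₁′, -1)`), transporting `T`, `T₃`, `T₄`
  obtain ⟨P₂, _, _, _, _, _, _, _, U₂, S₂, hO₂, hσ₂, he₂, hU₂, hS₂, hUS₂, hSS₂⟩ :=
    akhmedovPark2010_lemma8_rotation_step_transport (ι := Fin 2) hHF' (hS₁ 0).1 (hS₁ 0).2 hχ₁'
      hO₁ hσ₁ hU₁.1 hU₁.2 (hUS₁ 0) (S := ![S₁ 1, S₁ 2])
      (fun i => by fin_cases i <;> exact hS₁ _)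
      (fun i => by
        fin_cases i
        · exact hSS₁ 1 0 (by decide)
        · exact hSS₁ 2 0 (by decide))
      (fun i => by
        fin_cases i
        · exact hUS₁ 1
        · exact hUS₁ 2)
      (fun i j hij => by
        fin_cases i <;> fin_cases j
        · exact absurd rfl hij
        · exact hSS₁ 1 2 (by decide)
        · exact hSS₁ 2 1 (by decide)
        · exact absurd rfl hij)
  -- step 3: surgery on the transported `T₃` (`(a₂′ × c′, c′, +1)`), transporting `T`, `T₄`
  obtain ⟨P₃, _, _, _, _, _, _, _, U₃, S₃, hO₃, hσ₃, he₃, hU₃, hS₃, hUS₃, hSS₃⟩ :=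
    akhmedovPark2010_lemma8_rotation_step_transport (ι := Fin 1) hHF' (hS₂ 0).1 (hS₂ 0).2 hχ₂
      hO₂ hσ₂ hU₂.1 hU₂.2 (hUS₂ 0) (S := ![S₂ 1])
      (fun i => by fin_cases i; exact hS₂ _)
      (fun i => by
        fin_cases i
        exact hSS₂ 1 0 (by decide))
      (fun i => by
        fin_cases i
        exact hUS₂ 1)
      (fun i j hij => by
        fin_cases i; fin_cases j
        exact absurd rfl hij)
  -- step 4: surgery on the transported `T₄` (`(a₂″ × d′, d′, +1)`), transporting `T`
  obtain ⟨P₄, _, _, _, _, _, _, _, U₄, S₄, hO₄, hσ₄, he₄, hU₄, -, -, -⟩ :=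
    akhmedovPark2010_lemma8_rotation_step_transport (ι := Fin 0) hHF' (hS₃ 0).1 (hS₃ 0).2 hχ₂
      hO₃ hσ₃ hU₃.1 hU₃.2 (hUS₃ 0) (S := fun i => i.elim0)
      (fun i => i.elim0) (fun i => i.elim0) (fun i => i.elim0) (fun i => i.elim0)
  refine ⟨F, inferInstance, inferInstance, inferInstance, inferInstance, inferInstance,
    inferInstance, inferInstance, P₄, inferInstance, inferInstance, inferInstance, inferInstance,
    inferInstance, inferInstance, inferInstance, U₄, hHF, hO₄, hσ₄, ?_, hU₄.1, hU₄.2⟩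
  rw [he₄, he₃, he₂, he₁, heX]

end Literature.Barriers.SmoothPoincare4
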